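import Summits.BirchSwinnertonDyer.Rank1Residual.AdditivePotMult.QuadraticBaseChangeRealPeriod
import Summits.BirchSwinnertonDyer.Rank1Residual.AdditivePotMult.QuadraticBaseChangeDescentRankOne
import HarnessLib

/-!
# The A65-FREE base-change-and-descend ENDs over a REAL quadratic field (`K = ℚ(√p)`,
# `p ≡ 1 mod 4`), total analytic rank `≤ 1` (row T-MIL-REAL, FILE F-2; seat n1011-p01 GEN 7)

HONEST FRAMING (cell `b2b-bsdres`, run/shared/lean/b2b/bsd-rank1-residual/, verbatim in every
file): the goal of the cell is to DELETE the COMBINATION-SHAPED residual classes of the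
Birch–Swinnerton-Dyer formula for ALL analytic-rank `≤ 1` elliptic curves over `ℚ` — "full BSD
formula for every rank `≤ 1` curve in class `C`" assembled STRICTLY from published theorems — so
that the rank-`≤ 1` remainder becomes exactly the CONSTRUCTION-SHAPED classes, which are TYPED
(missing-input `Prop`s), NOT attempted. This is not "finishing BSD". Sub-classes X3♯(M) / X4(M)
(additive, potentially multiplicative prime; base-change-and-descend): a RESEARCH ROUTE; they stay
CONSTRUCTION-SHAPED; nothing is booked by this file; no mark / label moved. THEOREMS ONLY: no
definition, no named fact, no `sorry`.

## What (row T-MIL-REAL, `cells/n1011/skel/T-MIL-REAL.md` §1 (F-2))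

Every A65-free END so far (FILES D-2, E-3, E-4) needs `K` IMAGINARY (the archimedean comparison
of the tree). FILE F-1 (`QuadraticBaseChangeRealPeriod`) proved the REAL archimedean comparison
`Ω(W)·Ω(W^{(d_K)}) = 1 · Ω(W_K/K)`; FILE E-2's signature-agnostic schema
`milneQuotient_ordp_of_tamagawa_of_arch_of_regulator` and FILE E-1's regulator comparison in total
rank `≤ 1` (`exists_mul_regulator_baseChange_quadratic_of_rank_add_le_one`, `m ∈ {1, 2, 4}`) then
give, for `K` REAL quadratic with `d_K` odd squarefree — the CANONICAL field `K = ℚ(√p)` of an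
X3♯(M)/X4(M) pair at `p ≡ 1 (mod 4)` (`d_K = p`):

* `milneQuotient_ordp_of_tamagawa_real` — `hWR_p` from the odd Tamagawa identity, total rank
  `≤ 1`, `K` real;
* `milneQuotient_ordp_of_semistable'_real` / `milneQuotient_ordp_of_semistable_or_addv_real` —
  `hWR_p` DISCHARGED on S₁ (every odd `p`) / S₂ (`p ≥ 5`), fact-free;
* `bsdp_of_pPartOver_of_bsdp_twist_real_semistable` / `…_real_semistable_or_addv` — **THE A65-FREE
  DESCENT ENDs OVER A REAL QUADRATIC FIELD**: `W/ℚ`, `Wd = C_d • W^{(d_K)}`, `W' = C' • W_K`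
  globally minimal, `K` real quadratic with `d_K` odd squarefree, `W.analyticRank + Wd.analyticRank
  ≤ 1`, `W` on S₁ resp. S₂, `p` odd resp. `≥ 5`: **`BSDp W p ⟸ MissingPPartOverAt W' p ∧ BSDp Wd p`**,
  hypotheses `hGZK`, `hmod` only (`IsTotallyReal K` an explicit hypothesis `hreal`);
* `isTotallyReal_or_isTotallyComplex_of_finrank_eq_two` + **`bsdp_of_pPartOver_of_bsdp_twist_quadratic`
  — THE UNIFORM END**: either signature, `d_K` odd squarefree, total analytic rank `≤ 1`, one
  population condition merging S₁ and S₂ (additive places `≥ 5` prime to `d_K` allowed when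
  `p ≥ 5`), every odd `p`; hGZK + hmod only.

HONEST LIMITS: `d_K` odd squarefree (so `K = ℚ(√p)` needs `p ≡ 1 mod 4`; `p ≡ 3 mod 4` is the
imaginary file with `K = ℚ(√−p)`), total analytic rank `≤ 1`, odd `p`; X3♯(M)/X4(M) stay
CONSTRUCTION-SHAPED (`MissingPPartOverAt` untouched); TOOL/END theorems; closes no class; moves no
mark; A65 not consumed.

References: J. S. Milne, Invent. Math. 17 (1972) §1 Thm. 1, §2 [Milne1972ArithmeticAV];
T. Dokchitser, V. Dokchitser, Ann. of Math. 172 (2010) §2.1 [DokchitserDokchitserAnnals2010];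
B. Gross, D. Zagier, Invent. Math. 84 (1986) V.§2 [GrossZagier1986]; R. L. Miller, LMS J.
Comput. Math. 14 (2011) Def. 1.1 [Miller2011LMS].
-/

noncomputable section

open scoped Classical NumberField

open WeierstrassCurve NumberField NumberField.InfinitePlace IsDedekindDomain Rat.HeightOneSpectrum
  Literature.NumberTheory.EllipticCurves Literature.NumberTheory.EllipticCurves.Rank1Residual
  Literature.NumberTheory.EllipticCurves.Rank1Residual.Typed

namespace Summit.BirchSwinnertonDyer.Rank1Residual.AdditivePotMult

section RealEnds

variable (W : WeierstrassCurve ℚ) [W.IsElliptic] [W.IsGloballyMinimal] (p : ℕ) [hp : Fact p.Prime]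
  (K : Type) [Field K] [NumberField K]
  (Wd : WeierstrassCurve ℚ) [Wd.IsElliptic] [Wd.IsGloballyMinimal]
  (W' : WeierstrassCurve K) [W'.IsElliptic] [W'.IsGloballyMinimal]

/-! The signature hypothesis `IsTotallyReal K` is an EXPLICIT argument `hreal` throughout (it is a
mathematical hypothesis on `K`, never found by instance search for an abstract field, and it keeps
the real statements distinct from their imaginary twins of FILE E-3). -/

omit [W.IsGloballyMinimal] [Wd.IsGloballyMinimal] [W'.IsGloballyMinimal] in
/-- **`hWR_p` from the odd Tamagawa identity at `p`, total rank `≤ 1`, REAL quadratic `K`**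
(`Ш(W)`, `Ш(W_d)` finite; `p` odd): FILE E-2's schema with `n = 1` (FILE F-1
`realPeriodRat_mul_realPeriodRat_quadraticTwist_eq_bsdPeriod_of_isTotallyReal`) and `m ∈ {1,2,4}`
(FILE E-1 `exists_mul_regulator_baseChange_quadratic_of_rank_add_le_one`).
[cite: Milne1972ArithmeticAV, §1 Thm. 1 and §2 (through DokchitserDokchitserAnnals2010, §2.1, proof of Thm. 8)] -/
theorem milneQuotient_ordp_of_tamagawa_real (h2 : Module.finrank ℚ K = 2) (hreal : IsTotallyReal K)
    {Cd : VariableChange ℚ} (hWd : Cd • W.quadraticTwist (NumberField.discr K : ℚ) = Wd)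
    {C' : VariableChange K} (hW' : C' • W.baseChange K = W') [Finite W.sha] [Finite Wd.sha]
    (hr : W.mordellWeilRank + Wd.mordellWeilRank ≤ 1) (hp2 : p ≠ 2)
    (hT : padicValRat p (|Algebra.norm ℚ (C'.u : K)| * W'.tamagawaProduct : ℚ) =
      padicValRat p (|(Cd.u : ℚ)| * (W.tamagawaProduct * Wd.tamagawaProduct) : ℚ)) :
    ∃ q : ℚ, 0 < q ∧ padicValRat p q = 0 ∧
      (W'.shaOrder : ℝ) * W'.regulator * W'.bsdPeriod * (W'.tamagawaProduct : ℝ) /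
          (W'.torsionOrder : ℝ) ^ 2 = (q : ℝ) * (W.bsdRHS * Wd.bsdRHS) := by
  haveI := hreal
  obtain ⟨m, hm124, hm⟩ := exists_mul_regulator_baseChange_quadratic_of_rank_add_le_one W K h2 Wd
    ⟨Cd, hWd⟩ W' ⟨C', hW'⟩ hr
  have hm0 : m ≠ 0 := by rcases hm124 with rfl | rfl | rfl <;> norm_num
  haveI : Fact (Nat.Prime 2) := ⟨Nat.prime_two⟩
  have h2v : padicValRat p (2 : ℚ) = 0 := by
    rw [show (2 : ℚ) = ((2 : ℕ) : ℚ) by norm_num, padicValRat.of_nat, padicValNat_primes hp2,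
      Nat.cast_zero]
  have hmv : padicValRat p (m : ℚ) = 0 := by
    rcases hm124 with rfl | rfl | rfl
    · rw [Nat.cast_one, padicValRat.one]
    · exact_mod_cast h2v
    · rw [show ((4 : ℕ) : ℚ) = (2 : ℚ) ^ 2 by norm_num, padicValRat.pow, h2v, mul_zero]
  have hnv : padicValRat p ((1 : ℕ) : ℚ) = 0 := by rw [Nat.cast_one, padicValRat.one]
  exact milneQuotient_ordp_of_tamagawa_of_arch_of_regulator W K Wd W' h2 hWd hW' one_ne_zero hm0
    (realPeriodRat_mul_realPeriodRat_quadraticTwist_eq_bsdPeriod_of_isTotallyReal W K h2) hm p hp2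
    hnv hmv hT

/-- **DISCHARGE of `hWR_p` on S₁, REAL quadratic `K` (`d_K` odd squarefree), total rank `≤ 1`,
EVERY ODD `p`, FACT-FREE** (END #2, `padicValRat_norm_mul_tamagawaProduct_eq_of_semistable'`).
[cite: Milne1972ArithmeticAV, §1 Thm. 1 and §2 (through DokchitserDokchitserAnnals2010, §2.1, proof of Thm. 8)] -/
theorem milneQuotient_ordp_of_semistable'_real (h2 : Module.finrank ℚ K = 2) (hreal : IsTotallyReal K)
    (hdodd : Odd (NumberField.discr K)) (hdsq : Squarefree (NumberField.discr K))
    {Cd : VariableChange ℚ} (hWd : Cd • W.quadraticTwist (NumberField.discr K : ℚ) = Wd)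
    {C' : VariableChange K} (hW' : C' • W.baseChange K = W') [Finite W.sha] [Finite Wd.sha]
    (hr : W.mordellWeilRank + Wd.mordellWeilRank ≤ 1)
    (hS : ∀ v : HeightOneSpectrum (𝓞 ℚ), W.HasGoodReductionAt v ∨ W.HasMultiplicativeReductionAt v ∨
      (((primesEquiv v : ℕ) : ℤ) ∣ NumberField.discr K ∧ Wd.HasMultiplicativeReductionAt v))
    (hp2 : p ≠ 2) :
    ∃ q : ℚ, 0 < q ∧ padicValRat p q = 0 ∧
      (W'.shaOrder : ℝ) * W'.regulator * W'.bsdPeriod * (W'.tamagawaProduct : ℝ) /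
          (W'.torsionOrder : ℝ) ^ 2 = (q : ℝ) * (W.bsdRHS * Wd.bsdRHS) :=
  milneQuotient_ordp_of_tamagawa_real W p K Wd W' h2 hreal hWd hW' hr hp2
    (padicValRat_norm_mul_tamagawaProduct_eq_of_semistable' W K Wd W' h2 hdodd hdsq hWd hW' hS p hp2)

/-- **DISCHARGE of `hWR_p` on S₂, REAL quadratic `K`, total rank `≤ 1`, `p ≥ 5`** (END #3).
[cite: Milne1972ArithmeticAV, §1 Thm. 1 and §2 (through DokchitserDokchitserAnnals2010, §2.1, proof of Thm. 8)] -/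
theorem milneQuotient_ordp_of_semistable_or_addv_real (h2 : Module.finrank ℚ K = 2)
    (hreal : IsTotallyReal K) (hdodd : Odd (NumberField.discr K)) (hdsq : Squarefree (NumberField.discr K))
    {Cd : VariableChange ℚ} (hWd : Cd • W.quadraticTwist (NumberField.discr K : ℚ) = Wd)
    {C' : VariableChange K} (hW' : C' • W.baseChange K = W') [Finite W.sha] [Finite Wd.sha]
    (hr : W.mordellWeilRank + Wd.mordellWeilRank ≤ 1)
    (hS : ∀ v : HeightOneSpectrum (𝓞 ℚ), W.HasGoodReductionAt v ∨ W.HasMultiplicativeReductionAt v ∨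
      (((primesEquiv v : ℕ) : ℤ) ∣ NumberField.discr K ∧ Wd.HasMultiplicativeReductionAt v) ∨
      (W.HasAdditiveReductionAt v ∧ ¬ ((primesEquiv v : ℕ) : ℤ) ∣ NumberField.discr K ∧
        5 ≤ (primesEquiv v : ℕ)))
    (hp5 : 5 ≤ p) :
    ∃ q : ℚ, 0 < q ∧ padicValRat p q = 0 ∧
      (W'.shaOrder : ℝ) * W'.regulator * W'.bsdPeriod * (W'.tamagawaProduct : ℝ) /
          (W'.torsionOrder : ℝ) ^ 2 = (q : ℝ) * (W.bsdRHS * Wd.bsdRHS) :=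
  milneQuotient_ordp_of_tamagawa_real W p K Wd W' h2 hreal hWd hW' hr (by omega)
    (padicValRat_norm_mul_tamagawaProduct_eq_of_semistable_or_addv W K Wd W' h2 hdodd hdsq hWd hW'
      hS p hp5)

/-- **A65-FREE DESCENT END OVER A REAL QUADRATIC FIELD, S₁, EVERY ODD `p`.** Let `W/ℚ` be
globally minimal, `K` a REAL quadratic field with `d_K` odd squarefree (e.g. `K = ℚ(√p)` for the
additive prime `p ≡ 1 mod 4` of an X3♯(M)/X4(M) pair), `Wd = C_d • W^{(d_K)}` and `W' = C' • W_K`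
globally minimal, with `r_an(W) + r_an(Wd) ≤ 1`, `W` on S₁ (good ∨ multiplicative ∨ (`ℓ ∣ d_K` ∧
`Wd` multiplicative) at every place), `p` odd. THEN **`BSDp W p ⟸ MissingPPartOverAt W' p ∧
BSDp Wd p`**, hypotheses `hGZK`, `hmod` only; NO Milne hypothesis.
[cite: Milne1972ArithmeticAV, §1 Thm. 1 and §2 (through DokchitserDokchitserAnnals2010, §2.1, proof of Thm. 8)]
[cite: Miller2011LMS, Def. 1.1 (arXiv:1010.2431 p. 3)] -/
theorem bsdp_of_pPartOver_of_bsdp_twist_real_semistable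
    (hGZK : rank_eq_analyticRank_of_analyticRank_le_one) (hmod : hasEntireLFunction_rat)
    (h2 : Module.finrank ℚ K = 2) (hreal : IsTotallyReal K)
    (hdodd : Odd (NumberField.discr K)) (hdsq : Squarefree (NumberField.discr K))
    {Cd : VariableChange ℚ} (hWd : Cd • W.quadraticTwist (NumberField.discr K : ℚ) = Wd)
    {C' : VariableChange K} (hW' : C' • W.baseChange K = W')
    (hr : W.analyticRank + Wd.analyticRank ≤ 1)
    (hS : ∀ v : HeightOneSpectrum (𝓞 ℚ), W.HasGoodReductionAt v ∨ W.HasMultiplicativeReductionAt v ∨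
      (((primesEquiv v : ℕ) : ℤ) ∣ NumberField.discr K ∧ Wd.HasMultiplicativeReductionAt v))
    (hp2 : p ≠ 2) (hK : MissingPPartOverAt W' p) (hd : BSDp Wd p) : BSDp W p := by
  have hr1 : W.analyticRank ≤ 1 := by omega
  have hrd1 : Wd.analyticRank ≤ 1 := by omega
  obtain ⟨hrankW, hfinW⟩ := hGZK W hr1
  obtain ⟨hrankD, hfinD⟩ := hGZK Wd hrd1
  haveI : Finite W.sha := hfinW
  haveI : Finite Wd.sha := hfinD
  have hrMW : W.mordellWeilRank + Wd.mordellWeilRank ≤ 1 := by rw [hrankW, hrankD]; exact hr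
  exact bsdp_of_pPartOver_of_bsdp_twist_ordp W p K Wd W' hGZK hmod hr1 h2 ⟨Cd, hWd⟩ hrd1 ⟨C', hW'⟩
    (milneQuotient_ordp_of_semistable'_real W p K Wd W' h2 hreal hdodd hdsq hWd hW' hrMW hS hp2) hK hd

/-- **A65-FREE DESCENT END OVER A REAL QUADRATIC FIELD, S₂, `p ≥ 5`** (additive places of residue
characteristic `≥ 5` prime to `d_K` allowed; END #3). `hGZK`, `hmod` only.
[cite: Milne1972ArithmeticAV, §1 Thm. 1 and §2 (through DokchitserDokchitserAnnals2010, §2.1, proof of Thm. 8)]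
[cite: Miller2011LMS, Def. 1.1 (arXiv:1010.2431 p. 3)] -/
theorem bsdp_of_pPartOver_of_bsdp_twist_real_semistable_or_addv
    (hGZK : rank_eq_analyticRank_of_analyticRank_le_one) (hmod : hasEntireLFunction_rat)
    (h2 : Module.finrank ℚ K = 2) (hreal : IsTotallyReal K)
    (hdodd : Odd (NumberField.discr K)) (hdsq : Squarefree (NumberField.discr K))
    {Cd : VariableChange ℚ} (hWd : Cd • W.quadraticTwist (NumberField.discr K : ℚ) = Wd)
    {C' : VariableChange K} (hW' : C' • W.baseChange K = W')
    (hr : W.analyticRank + Wd.analyticRank ≤ 1)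
    (hS : ∀ v : HeightOneSpectrum (𝓞 ℚ), W.HasGoodReductionAt v ∨ W.HasMultiplicativeReductionAt v ∨
      (((primesEquiv v : ℕ) : ℤ) ∣ NumberField.discr K ∧ Wd.HasMultiplicativeReductionAt v) ∨
      (W.HasAdditiveReductionAt v ∧ ¬ ((primesEquiv v : ℕ) : ℤ) ∣ NumberField.discr K ∧
        5 ≤ (primesEquiv v : ℕ)))
    (hp5 : 5 ≤ p) (hK : MissingPPartOverAt W' p) (hd : BSDp Wd p) : BSDp W p := by
  have hr1 : W.analyticRank ≤ 1 := by omega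
  have hrd1 : Wd.analyticRank ≤ 1 := by omega
  obtain ⟨hrankW, hfinW⟩ := hGZK W hr1
  obtain ⟨hrankD, hfinD⟩ := hGZK Wd hrd1
  haveI : Finite W.sha := hfinW
  haveI : Finite Wd.sha := hfinD
  have hrMW : W.mordellWeilRank + Wd.mordellWeilRank ≤ 1 := by rw [hrankW, hrankD]; exact hr
  exact bsdp_of_pPartOver_of_bsdp_twist_ordp W p K Wd W' hGZK hmod hr1 h2 ⟨Cd, hWd⟩ hrd1 ⟨C', hW'⟩
    (milneQuotient_ordp_of_semistable_or_addv_real W p K Wd W' h2 hreal hdodd hdsq hWd hW' hrMW hS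
      hp5) hK hd

end RealEnds

/-! ## Either signature: the uniform A65-free END for a quadratic field with odd squarefree
discriminant -/

section AnySignature

/-- A quadratic number field is totally real or totally complex (`r₁ + 2 r₂ = 2`; Mathlib
`card_add_two_mul_card_eq_rank`, `nrComplexPlaces_eq_zero_iff`, `nrRealPlaces_eq_zero_iff`).
[folklore] -/
theorem isTotallyReal_or_isTotallyComplex_of_finrank_eq_two (K : Type*) [Field K] [NumberField K]
    (h2 : Module.finrank ℚ K = 2) : IsTotallyReal K ∨ IsTotallyComplex K := by
  have h := card_add_two_mul_card_eq_rank K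
  rw [h2] at h
  rcases Nat.eq_zero_or_pos (nrComplexPlaces K) with h0 | hpos
  · exact Or.inl (nrComplexPlaces_eq_zero_iff.mp h0)
  · exact Or.inr (nrRealPlaces_eq_zero_iff.mp (by omega))

variable (W : WeierstrassCurve ℚ) [W.IsElliptic] [W.IsGloballyMinimal] (p : ℕ) [hp : Fact p.Prime]
  (K : Type) [Field K] [NumberField K]
  (Wd : WeierstrassCurve ℚ) [Wd.IsElliptic] [Wd.IsGloballyMinimal]
  (W' : WeierstrassCurve K) [W'.IsElliptic] [W'.IsGloballyMinimal]

/-- **THE UNIFORM A65-FREE BASE-CHANGE-AND-DESCEND END.** `W/ℚ`, `Wd = C_d • W^{(d_K)}`,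
`W' = C' • W_K` globally minimal; `[K:ℚ] = 2` of EITHER signature with `d_K` odd squarefree — e.g.
the canonical `K = ℚ(√p*)`, `p* = (−1)^{(p−1)/2} p`, of an X3♯(M)/X4(M) pair at ANY odd `p`;
`r_an(W) + r_an(Wd) ≤ 1`; `p` odd; and ONE population condition merging S₁ and S₂: at every
place `v`, `W` is good ∨ multiplicative ∨ (`ℓ_v ∣ d_K` ∧ `Wd` multiplicative) ∨ (`W` additive with
`ℓ_v ∤ d_K`, `ℓ_v ≥ 5` AND `p ≥ 5`). THEN **`BSDp W p ⟸ MissingPPartOverAt W' p ∧ BSDp Wd p`**,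
hypotheses `hGZK`, `hmod` ONLY — no Milne A65, no `hshaK`, no `hWR`. Signature dichotomy
(`isTotallyReal_or_isTotallyComplex_of_finrank_eq_two`): real `K` by this file, imaginary `K` by
FILE E-3's `…_rankLeOne_semistable[_or_addv]`; `p ≥ 5` routes to S₂, `p = 3` forces the S₁ shape
(the last disjunct is then empty). [cite: Milne1972ArithmeticAV, §1 Thm. 1 and §2 (through DokchitserDokchitserAnnals2010, §2.1, proof of Thm. 8)]
[cite: Miller2011LMS, Def. 1.1 (arXiv:1010.2431 p. 3)] -/
theorem bsdp_of_pPartOver_of_bsdp_twist_quadratic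
    (hGZK : rank_eq_analyticRank_of_analyticRank_le_one) (hmod : hasEntireLFunction_rat)
    (h2 : Module.finrank ℚ K = 2)
    (hdodd : Odd (NumberField.discr K)) (hdsq : Squarefree (NumberField.discr K))
    {Cd : VariableChange ℚ} (hWd : Cd • W.quadraticTwist (NumberField.discr K : ℚ) = Wd)
    {C' : VariableChange K} (hW' : C' • W.baseChange K = W')
    (hr : W.analyticRank + Wd.analyticRank ≤ 1)
    (hS : ∀ v : HeightOneSpectrum (𝓞 ℚ), W.HasGoodReductionAt v ∨ W.HasMultiplicativeReductionAt v ∨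
      (((primesEquiv v : ℕ) : ℤ) ∣ NumberField.discr K ∧ Wd.HasMultiplicativeReductionAt v) ∨
      (W.HasAdditiveReductionAt v ∧ ¬ ((primesEquiv v : ℕ) : ℤ) ∣ NumberField.discr K ∧
        5 ≤ (primesEquiv v : ℕ) ∧ 5 ≤ p))
    (hp2 : p ≠ 2) (hK : MissingPPartOverAt W' p) (hd : BSDp Wd p) : BSDp W p := by
  by_cases hp5 : 5 ≤ p
  · -- S₂ at `p ≥ 5`
    have hS' : ∀ v : HeightOneSpectrum (𝓞 ℚ), W.HasGoodReductionAt v ∨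
        W.HasMultiplicativeReductionAt v ∨
        (((primesEquiv v : ℕ) : ℤ) ∣ NumberField.discr K ∧ Wd.HasMultiplicativeReductionAt v) ∨
        (W.HasAdditiveReductionAt v ∧ ¬ ((primesEquiv v : ℕ) : ℤ) ∣ NumberField.discr K ∧
          5 ≤ (primesEquiv v : ℕ)) := fun v =>
      (hS v).imp_right (Or.imp_right (Or.imp_right fun h => ⟨h.1, h.2.1, h.2.2.1⟩))
    rcases isTotallyReal_or_isTotallyComplex_of_finrank_eq_two K h2 with hR | hC
    · exact bsdp_of_pPartOver_of_bsdp_twist_real_semistable_or_addv W p K Wd W' hGZK hmod h2 hR hdodd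
        hdsq hWd hW' hr hS' hp5 hK hd
    · haveI := hC
      exact bsdp_of_pPartOver_of_bsdp_twist_rankLeOne_semistable_or_addv W p K Wd W' hGZK hmod h2
        hdodd hdsq hWd hW' hr hS' hp5 hK hd
  · -- `p = 3` (odd, `< 5`): the last disjunct is empty, so `W` is on S₁
    have hS' : ∀ v : HeightOneSpectrum (𝓞 ℚ), W.HasGoodReductionAt v ∨
        W.HasMultiplicativeReductionAt v ∨
        (((primesEquiv v : ℕ) : ℤ) ∣ NumberField.discr K ∧ Wd.HasMultiplicativeReductionAt v) :=
      fun v => by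
        rcases hS v with h | h | h | h
        · exact Or.inl h
        · exact Or.inr (Or.inl h)
        · exact Or.inr (Or.inr h)
        · exact absurd h.2.2.2 hp5
    rcases isTotallyReal_or_isTotallyComplex_of_finrank_eq_two K h2 with hR | hC
    · exact bsdp_of_pPartOver_of_bsdp_twist_real_semistable W p K Wd W' hGZK hmod h2 hR hdodd hdsq
        hWd hW' hr hS' hp2 hK hd
    · haveI := hC
      exact bsdp_of_pPartOver_of_bsdp_twist_rankLeOne_semistable W p K Wd W' hGZK hmod h2 hdodd hdsq
        hWd hW' hr hS' hp2 hK hd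

end AnySignature

end Summit.BirchSwinnertonDyer.Rank1Residual.AdditivePotMult

end
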